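import Literature.AlgebraicGeometry.Resolution.AlterationsFormalNodes
import Mathlib.RingTheory.KrullDimension.NonZeroDivisors
import Mathlib.RingTheory.Ideal.KrullsHeightTheorem
import Mathlib.RingTheory.Ideal.Cotangent
import Mathlib.RingTheory.Flat.FaithfullyFlat.Algebra
import Mathlib.RingTheory.AdicCompletion.AsTensorProduct
import Mathlib.Data.Finsupp.Antidiagonal
import HarnessLib

/-!
# De Jong's alteration theorem: formal normal crossings at the regular points of `Sing(f)`
# (de Jong 1996, 3.3: "if `Σ nᵢ = 1`, then the point `x` is regular on `X`") — proof

Topic: `Literature/AlgebraicGeometry/Resolution`. Discharges the named fact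
`DeJong1996SemiStableBoundaryNormalCrossingsSingF` (`AlterationsBoundarySmoothLocus.lean`: at a
closed point `x ∈ Z` of the curve of a pair in Situation 4.23 with `𝒪_{X,x}` regular but `f` not
smooth at `x`, `(𝒪̂_{X,x}, Î_Z) ≅ (k⟦X₁, …, X_d⟧, (X₁ ⋯ X_r))`) from the formal nodal structure
`DeJong1996SplitNodalStructure` (`AlterationsFormalNodes.lean`, de Jong 1996, 2.23 + 3.3:
`𝒪̂_{X,x} ≅ k⟦u, v, T₁, …, T_m⟧/(uv - ∏ Tᵢ^{νᵢ})` with `f^#(tᵢ) ↦ Tᵢ`). The printed argument is the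
parenthesis of 3.3, "(if `Σ nᵢ = 1`, then the point `x` is regular on `X`)", read backwards, and
the sentence of 4.24 "`Z` is already everywhere a divisor with normal crossings, except in the
singular points of `X`": at a regular `x ∈ Sing(f)`, `𝒪̂_{X,x} ≅ k⟦T⟧⟦u, v⟧/(uv - t₁) ≅
k⟦u, v, t₂, …, t_m⟧` and `Z = f⁻¹(D) = {uv · t₂ ⋯ t_ρ = 0}`.

The proof, for `B = 𝒪_{X,x}`, `B̂ ≅ M = k⟦u, v, T⟧/(g)`, `g = uv - ∏ Tᵢ^{νᵢ}`:

* **embedding dimension of `M`** (`MvPowerSeries.linearIndependent_toCotangent_of_surjective`):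
  for a surjection `π : k⟦Xⱼ⟧ → M` onto a local ring whose kernel has no linear terms in the
  variables `Xⱼ, j ∈ S`, the classes of these `Xⱼ` in `𝔪_M/𝔪_M²` are linearly independent (a
  relation lifts to `Σ Aⱼ Xⱼ ∈ 𝔫² + ker π`, whose `Xⱼ`-coefficients `Aⱼ(0)` vanish); the kernel
  `(g)` has no linear term in `u`, `v`, and none in `Tᵢ` unless `ν = δᵢ`
  (`coeff_single_one_formalNodeRelation_inr`);
* **dimension of `M`**: `dim M ≤ m + 1` (`g ≠ 0` in the `(m+2)`-generated local domain `k⟦u, v, T⟧`,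
  `FormalNodeRing.ringKrullDim_le`); hence if `M` is regular (`dim = emb dim`), `ν` is a single
  `δ_{i₀}` — for `Σ νᵢ ≥ 2` all `m + 2` variables would be independent — and `dim M = m + 1`
  (`FormalNodeRing.exists_eq_single_of_isRegularLocalRing`): this is "`Σ nᵢ = 1`";
* **formal coordinates**: `u, v, Tᵢ (i ≠ i₀)` is then a regular system of parameters of the complete
  regular local ring `B̂`, so Cohen's theorem in the sharp form of `AlterationsFormalCoordinates.lean`
  gives `B̂ ≅ k⟦X₁, …, X_{m+1}⟧` with these parameters as variables; `dim B̂ = dim B = dim X = d`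
  forces `d = m + 1`;
* **the ideal**: `x` lies on no section (the sections map into the smooth locus), so `I(Z)_x` is
  the radical of `(f^#(t₁ ⋯ t_ρ))`; in `B̂`, `t₁ ⋯ t_ρ = uv · ∏_{i<ρ, i≠i₀} Tᵢ` is a product of
  `ρ + 1` distinct regular parameters, generating a radical ideal; by faithful flatness of
  `B → B̂` the ideal `(f^#(t₁ ⋯ t_ρ))` is already radical, and its completion is carried to
  `(X₁ ⋯ X_{ρ+1})`.

Whence `DeJong1996SemiStableBoundaryNormalCrossingsSingF.of_splitNodalStructure`, B2 of the 4.24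
DAG (`DeJong1996SemiStableBoundaryNormalCrossings.of_splitNodalStructure`), and the target of the
owning unit from Lemma 3.2, the split nodal structure and the two facts of 3.5
(`DeJong1996SemiStablePairNormalForm.of_lemma32_of_splitNodal_of_nodal_of_components`).

## Sources

* A. J. de Jong, *Smoothness, semi-stability and alterations*, Publ. Math. IHÉS 83 (1996), 2.23,
  3.3 (pp. 61–63), 4.24–4.25 (p. 75).
* H. Matsumura, *Commutative Ring Theory* (1986), Thm. 14.2 (regular local rings: minimal bases
  of `𝔪`, members of a regular system of parameters are prime), Thm. 29.7 (Cohen).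
-/

noncomputable section

open CategoryTheory CategoryTheory.Limits AlgebraicGeometry TopologicalSpace Topology
  IsLocalRing

namespace Literature.AlgebraicGeometry.Resolution

universe u

open Scheme.IdealSheafData

/-! ## Linear terms of power series -/

section DegreeOne

variable {σ : Type*} {R : Type*} [CommRing R]

/-- The coefficient of `Xⱼ` in a product: `(φψ)ⱼ = φ(0) ψⱼ + φⱼ ψ(0)`. [folklore] -/
theorem MvPowerSeries.coeff_single_one_mul (j : σ) (φ ψ : MvPowerSeries σ R) :
    MvPowerSeries.coeff (Finsupp.single j 1) (φ * ψ) =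
      MvPowerSeries.constantCoeff φ * MvPowerSeries.coeff (Finsupp.single j 1) ψ +
        MvPowerSeries.coeff (Finsupp.single j 1) φ * MvPowerSeries.constantCoeff ψ := by
  classical
  rw [MvPowerSeries.coeff_mul, Finsupp.antidiagonal_single, Finset.sum_map]
  rw [show Finset.antidiagonal 1 = {((0 : ℕ), 1), (1, 0)} from rfl, Finset.sum_insert (by decide),
    Finset.sum_singleton]
  simp only [Function.Embedding.coe_prodMap, Function.Embedding.coeFn_mk, Prod.map_apply,
    Finsupp.single_zero, MvPowerSeries.coeff_zero_eq_constantCoeff_apply]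

/-- A variable has no constant term, so lies in the maximal ideal of `k⟦X⟧`. [folklore] -/
theorem MvPowerSeries.X_mem_maximalIdeal {k : Type*} [Field k] (j : σ) :
    (MvPowerSeries.X j : MvPowerSeries σ k) ∈ maximalIdeal (MvPowerSeries σ k) := by
  rw [mem_maximalIdeal, mem_nonunits_iff, MvPowerSeries.isUnit_iff_constantCoeff,
    MvPowerSeries.constantCoeff_X]
  exact not_isUnit_zero

/-- Over a field, a power series lies in the maximal ideal iff its constant term vanishes.
[folklore] -/
theorem MvPowerSeries.mem_maximalIdeal_iff_constantCoeff {k : Type*} [Field k]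
    {φ : MvPowerSeries σ k} :
    φ ∈ maximalIdeal (MvPowerSeries σ k) ↔ MvPowerSeries.constantCoeff φ = 0 := by
  rw [mem_maximalIdeal, mem_nonunits_iff, MvPowerSeries.isUnit_iff_constantCoeff,
    isUnit_iff_ne_zero, not_not]

/-- Elements of `𝔫²`, `𝔫` the maximal ideal of `k⟦X⟧`, have no linear terms. [folklore] -/
theorem MvPowerSeries.coeff_single_one_eq_zero_of_mem_sq {k : Type*} [Field k] (j : σ)
    {φ : MvPowerSeries σ k} (hφ : φ ∈ maximalIdeal (MvPowerSeries σ k) ^ 2) :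
    MvPowerSeries.coeff (Finsupp.single j 1) φ = 0 := by
  rw [pow_two] at hφ
  refine Submodule.mul_induction_on hφ (fun p hp q hq => ?_) (fun p q hp hq => ?_)
  · rw [MvPowerSeries.coeff_single_one_mul,
      MvPowerSeries.mem_maximalIdeal_iff_constantCoeff.mp hp,
      MvPowerSeries.mem_maximalIdeal_iff_constantCoeff.mp hq, zero_mul, mul_zero, add_zero]
  · rw [map_add, hp, hq, add_zero]

/-- A product of powers of variables is the monomial of the summed exponents. [folklore] -/
theorem MvPowerSeries.prod_X_pow_eq_monomial {ι : Type*} (s : Finset ι) (v : ι → σ) (n : ι → ℕ) :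
    ∏ i ∈ s, (MvPowerSeries.X (v i) : MvPowerSeries σ R) ^ (n i) =
      MvPowerSeries.monomial (∑ i ∈ s, Finsupp.single (v i) (n i)) 1 := by
  classical
  induction s using Finset.induction_on with
  | empty => simp
  | insert a s ha ih =>
    rw [Finset.prod_insert ha, Finset.sum_insert ha, ih, MvPowerSeries.X_pow_eq,
      MvPowerSeries.monomial_mul_monomial, one_mul]

end DegreeOne

/-! ## Embedding dimension of quotients of power series rings -/

/-- **Linear independence in the cotangent space of a quotient of a power series ring.** Let
`π : k⟦Xⱼ : j ∈ σ⟧ → M` be a surjective (local) homomorphism onto a local ring and `S ⊆ σ` a set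
of variables such that no element of `ker π` has a linear term in a variable of `S`. Then the
classes of `π(Xⱼ)`, `j ∈ S`, in `𝔪_M/𝔪_M²` are linearly independent over the residue field:
a relation `Σ aⱼ π(Xⱼ) ∈ 𝔪_M²` lifts to `Σ Aⱼ Xⱼ ∈ 𝔫² + ker π`, and comparing `Xⱼ`-coefficients
gives `Aⱼ(0) = 0`, i.e. `aⱼ = 0` in the residue field. [folklore] -/
theorem MvPowerSeries.linearIndependent_toCotangent_of_surjective {σ : Type*} {k : Type*}
    [Field k] {M : Type*} [CommRing M] [IsLocalRing M] (π : MvPowerSeries σ k →+* M)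
    [IsLocalHom π] (hπ : Function.Surjective π) (S : Set σ)
    (hker : ∀ φ ∈ RingHom.ker π, ∀ j ∈ S, MvPowerSeries.coeff (Finsupp.single j 1) φ = 0) :
    LinearIndependent (ResidueField M) fun j : S =>
      (maximalIdeal M).toCotangent
        ⟨π (MvPowerSeries.X (j : σ)), map_nonunit π _ (MvPowerSeries.X_mem_maximalIdeal (j : σ))⟩ := by
  classical
  rw [linearIndependent_iff']
  intro s a hsum j hjs
  -- lift the coefficients to power series
  have hlift : ∀ i : S, ∃ A : MvPowerSeries σ k, IsLocalRing.residue M (π A) = a i := fun i => by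
    obtain ⟨r, hr⟩ := IsLocalRing.residue_surjective (a i)
    obtain ⟨A, rfl⟩ := hπ r
    exact ⟨A, hr⟩
  choose A hA using hlift
  set mS : S → maximalIdeal M := fun i =>
    ⟨π (MvPowerSeries.X (i : σ)), map_nonunit π _ (MvPowerSeries.X_mem_maximalIdeal (i : σ))⟩
    with hmS
  -- the relation is `toCotangent (Σ π(Aᵢ) • mᵢ) = 0`
  have hsum' : (maximalIdeal M).toCotangent (∑ i ∈ s, (π (A i)) • mS i) = 0 := by
    rw [map_sum, ← hsum]
    refine Finset.sum_congr rfl fun i _ => ?_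
    rw [LinearMap.map_smul, ← hA i]
    rfl
  rw [Ideal.toCotangent_eq_zero] at hsum'
  have hval : ((∑ i ∈ s, (π (A i)) • mS i : maximalIdeal M) : M) =
      π (∑ i ∈ s, A i * MvPowerSeries.X (i : σ)) := by
    rw [map_sum, Submodule.coe_sum]
    refine Finset.sum_congr rfl fun i _ => ?_
    rw [Submodule.coe_smul, smul_eq_mul, map_mul]
  rw [hval] at hsum'
  -- `𝔪_M = π(𝔫)`, so `𝔪_M² = π(𝔫²)`
  have hmax : maximalIdeal M = (maximalIdeal (MvPowerSeries σ k)).map π := by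
    rw [← IsLocalRing.maximalIdeal_comap π, Ideal.map_comap_of_surjective π hπ]
  rw [hmax, ← Ideal.map_pow, Ideal.mem_map_iff_of_surjective π hπ] at hsum'
  obtain ⟨q, hq, hπq⟩ := hsum'
  have hker' : (∑ i ∈ s, A i * MvPowerSeries.X (i : σ)) - q ∈ RingHom.ker π := by
    rw [RingHom.mem_ker, map_sub, hπq, sub_self]
  have h1 := hker _ hker' j j.2
  rw [map_sub, MvPowerSeries.coeff_single_one_eq_zero_of_mem_sq (j : σ) hq, sub_zero,
    map_sum] at h1
  -- the `Xⱼ`-coefficient of `Σ Aᵢ Xᵢ` is `Aⱼ(0)`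
  have h2 : ∀ i ∈ s, MvPowerSeries.coeff (Finsupp.single (j : σ) 1)
      (A i * MvPowerSeries.X (i : σ)) = if i = j then MvPowerSeries.constantCoeff (A i) else 0 := by
    intro i _
    rw [MvPowerSeries.coeff_single_one_mul, MvPowerSeries.constantCoeff_X, mul_zero, add_zero,
      MvPowerSeries.coeff_X]
    by_cases hij : i = j
    · subst hij
      rw [if_pos rfl, if_pos rfl, mul_one]
    · rw [if_neg, if_neg hij, mul_zero]
      intro h
      exact hij (Subtype.ext (Finsupp.single_left_injective one_ne_zero h).symm)
  rw [Finset.sum_congr rfl h2, Finset.sum_ite_eq' s j, if_pos hjs] at h1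
  -- so `Aⱼ ∈ 𝔫` and `aⱼ = 0`
  rw [← hA j, IsLocalRing.residue_eq_zero_iff, hmax]
  exact Ideal.mem_map_of_mem π (MvPowerSeries.mem_maximalIdeal_iff_constantCoeff.mpr h1)

/-- Consequently, if moreover `M` is a regular local ring, the number of such variables is at
most `dim M` (`emb dim M = dim M`). [folklore] -/
theorem MvPowerSeries.card_le_ringKrullDim_of_surjective {σ : Type*} {k : Type*} [Field k]
    {M : Type*} [CommRing M] [IsRegularLocalRing M] (π : MvPowerSeries σ k →+* M)
    (hπ : Function.Surjective π) (S : Finset σ)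
    (hker : ∀ φ ∈ RingHom.ker π, ∀ j ∈ S, MvPowerSeries.coeff (Finsupp.single j 1) φ = 0) :
    (S.card : WithBot ℕ∞) ≤ ringKrullDim M := by
  haveI : IsLocalHom π := IsLocalHom.of_surjective π hπ
  have hli := MvPowerSeries.linearIndependent_toCotangent_of_surjective π hπ (S : Set σ)
    (fun φ hφ j hj => hker φ hφ j hj)
  have hcard := hli.fintype_card_le_finrank
  rw [← Nat.card_eq_fintype_card, Nat.card_coe_set_eq, Set.ncard_coe_finset] at hcard
  have hreg := (IsRegularLocalRing.iff_finrank_cotangentSpace M).mp inferInstance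
  rw [← hreg]
  exact_mod_cast hcard

/-! ## The formal node ring: linear terms of the relation, dimension -/

namespace DeJong1996

namespace FormalNodeRing

variable (k : Type u) [Field k] (m : ℕ) (ν : Fin m → ℕ)

/-- The exponent of the monomial `∏ Tᵢ^{νᵢ}`. [folklore] -/
theorem prod_X_pow_eq :
    ∏ i, (MvPowerSeries.X (Sum.inr i) : MvPowerSeries (Fin 2 ⊕ Fin m) k) ^ (ν i) =
      MvPowerSeries.monomial (∑ i, Finsupp.single (Sum.inr i : Fin 2 ⊕ Fin m) (ν i)) 1 :=
  MvPowerSeries.prod_X_pow_eq_monomial _ _ _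

/-- The exponent `∑ νᵢ e_{Tᵢ}` vanishes on `u`, `v`. [folklore] -/
theorem sum_single_apply_inl (a : Fin 2) :
    (∑ i, Finsupp.single (Sum.inr i : Fin 2 ⊕ Fin m) (ν i)) (Sum.inl a) = 0 := by
  rw [Finsupp.finsetSum_apply]
  exact Finset.sum_eq_zero fun i _ => by rw [Finsupp.single_apply, if_neg Sum.inr_ne_inl]

/-- The exponent `∑ νᵢ e_{Tᵢ}` takes the value `νᵢ` on `Tᵢ`. [folklore] -/
theorem sum_single_apply_inr (i : Fin m) :
    (∑ i, Finsupp.single (Sum.inr i : Fin 2 ⊕ Fin m) (ν i)) (Sum.inr i) = ν i := by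
  classical
  rw [Finsupp.finsetSum_apply]
  simp_rw [Finsupp.single_apply, Sum.inr.injEq]
  rw [Finset.sum_ite_eq' Finset.univ i, if_pos (Finset.mem_univ i)]

/-- The relation `uv - ∏ Tᵢ^{νᵢ}` has no linear term in `u` or `v`. [folklore] -/
theorem coeff_single_one_formalNodeRelation_inl (a : Fin 2) :
    MvPowerSeries.coeff (Finsupp.single (Sum.inl a : Fin 2 ⊕ Fin m) 1)
      (formalNodeRelation k m ν) = 0 := by
  classical
  unfold formalNodeRelation
  rw [map_sub, MvPowerSeries.coeff_single_one_mul, MvPowerSeries.constantCoeff_X,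
    MvPowerSeries.constantCoeff_X, zero_mul, mul_zero, add_zero, zero_sub, neg_eq_zero,
    prod_X_pow_eq, MvPowerSeries.coeff_monomial, if_neg]
  intro h
  have := congrArg (fun D => D (Sum.inl a)) h
  simp only [Finsupp.single_eq_same, sum_single_apply_inl] at this
  exact one_ne_zero this

/-- The relation `uv - ∏ Tᵢ^{νᵢ}` has no linear term in `Tᵢ` unless `ν = δᵢ`. [folklore] -/
theorem coeff_single_one_formalNodeRelation_inr (i : Fin m) (hν : ν ≠ Pi.single i 1) :
    MvPowerSeries.coeff (Finsupp.single (Sum.inr i : Fin 2 ⊕ Fin m) 1)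
      (formalNodeRelation k m ν) = 0 := by
  classical
  unfold formalNodeRelation
  rw [map_sub, MvPowerSeries.coeff_single_one_mul, MvPowerSeries.constantCoeff_X,
    MvPowerSeries.constantCoeff_X, zero_mul, mul_zero, add_zero, zero_sub, neg_eq_zero,
    prod_X_pow_eq, MvPowerSeries.coeff_monomial, if_neg]
  intro h
  apply hν
  funext i'
  have := congrArg (fun D => D (Sum.inr i')) h
  simp only [sum_single_apply_inr, Finsupp.single_apply, Sum.inr.injEq] at this
  rw [← this, Pi.single_apply]
  by_cases hi : i' = i
  · subst hi
    simp
  · rw [if_neg (Ne.symm hi), if_neg hi]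

/-- The relation `uv - ∏ Tᵢ^{νᵢ}` is non-zero: its `uv`-coefficient is `1`. [folklore] -/
theorem formalNodeRelation_ne_zero : formalNodeRelation k m ν ≠ 0 := by
  classical
  intro h
  have h1 := congrArg (MvPowerSeries.coeff
    (Finsupp.single (Sum.inl 0 : Fin 2 ⊕ Fin m) 1 + Finsupp.single (Sum.inl 1) 1)) h
  unfold formalNodeRelation at h1
  rw [map_zero, map_sub, prod_X_pow_eq, MvPowerSeries.coeff_monomial, if_neg,
    sub_zero, MvPowerSeries.X, MvPowerSeries.X, MvPowerSeries.monomial_mul_monomial,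
    MvPowerSeries.coeff_monomial_same, mul_one] at h1
  · exact one_ne_zero h1
  · intro h2
    have := congrArg (fun D => D (Sum.inl 0)) h2
    simp only [Finsupp.coe_add, Pi.add_apply, Finsupp.single_eq_same, sum_single_apply_inl,
      Finsupp.single_apply] at this
    simp at this

/-- **`dim k⟦u, v, T₁, …, T_m⟧/(uv - ∏ Tᵢ^{νᵢ}) ≤ m + 1`**: the relation is a non-zero element of
the local domain `k⟦u, v, T⟧`, whose maximal ideal is generated by `m + 2` elements (Krull's
height theorem). [folklore] -/
theorem ringKrullDim_le : ringKrullDim (FormalNodeRing k m ν) ≤ (m + 1 : ℕ) := by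
  classical
  set P := MvPowerSeries (Fin 2 ⊕ Fin m) k with hP
  haveI : IsNoetherianRing P := isNoetherianRing_mvPowerSeries k (Fin 2 ⊕ Fin m)
  -- `dim P ≤ m + 2`
  have hgen : maximalIdeal P = Ideal.span (Set.range (MvPowerSeries.X : Fin 2 ⊕ Fin m → P)) := by
    letI : LinearOrder (Fin 2 ⊕ Fin m) := LinearOrder.lift' finSumFinEquiv finSumFinEquiv.injective
    exact maximalIdeal_mvPowerSeries_eq_span_range_X k
  have hfin : (Set.range (MvPowerSeries.X : Fin 2 ⊕ Fin m → P)).Finite := Set.finite_range _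
  have hcard : (Set.range (MvPowerSeries.X : Fin 2 ⊕ Fin m → P)).ncard = m + 2 := by
    rw [Set.ncard_range_of_injective (fun a b h => MvPowerSeries.X_inj.mp h), Nat.card_eq_fintype_card,
      Fintype.card_sum, Fintype.card_fin, Fintype.card_fin, add_comm]
  have hP2 : ringKrullDim P ≤ (m + 2 : ℕ) := by
    refine (ringKrullDim_le_spanFinrank_maximalIdeal P).trans ?_
    have h : (Ideal.span (Set.range (MvPowerSeries.X : Fin 2 ⊕ Fin m → P))).spanFinrank ≤
        (Set.range (MvPowerSeries.X : Fin 2 ⊕ Fin m → P)).ncard :=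
      Submodule.spanFinrank_span_le_ncard_of_finite (R := P) hfin
    rw [← hgen, hcard] at h
    exact_mod_cast h
  -- `dim M + 1 ≤ dim P`
  have hg : formalNodeRelation k m ν ∈ nonZeroDivisors P :=
    mem_nonZeroDivisors_of_ne_zero (formalNodeRelation_ne_zero k m ν)
  have h1 := ringKrullDim_quotient_succ_le_of_nonZeroDivisor hg
  have h2 : ringKrullDim (FormalNodeRing k m ν) + 1 ≤ ((m + 1 : ℕ) : WithBot ℕ∞) + 1 := by
    refine h1.trans (hP2.trans ?_)
    exact le_of_eq (by push_cast; ring)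
  exact ENat.WithBot.add_le_add_one_right_iff.mp h2

variable {k m ν}

/-- **"If `Σ nᵢ = 1`, then the point `x` is regular on `X`" — and conversely** (de Jong 1996,
3.3): if a REGULAR local ring `R` is isomorphic to `k⟦u, v, T₁, …, T_m⟧/(uv - ∏ Tᵢ^{νᵢ})`, then
`ν = δ_{i₀}` for a single index `i₀` and `dim R = m + 1`. (For `Σ νᵢ ≥ 2` the relation has no
linear terms, so `emb dim R = m + 2 > m + 1 ≥ dim R`; for `ν = δ_{i₀}` the `m + 1` variables other
than `T_{i₀}` stay independent modulo `𝔪²`, so `dim R = emb dim R ≥ m + 1`; `ν = 0` would make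
`R = 0`.) [cite: DeJong1996, 3.3, p. 63] -/
theorem exists_eq_single_of_isRegularLocalRing {R : Type*} [CommRing R] [IsRegularLocalRing R]
    (e : R ≃+* FormalNodeRing k m ν) :
    ∃ i₀ : Fin m, ν = Pi.single i₀ 1 ∧ ringKrullDim R = (m + 1 : ℕ) := by
  classical
  set P := MvPowerSeries (Fin 2 ⊕ Fin m) k with hP
  -- the surjection `π = e⁻¹ ∘ mk : P → R`, with kernel `(g)`
  set π : P →+* R := e.symm.toRingHom.comp (Ideal.Quotient.mk _) with hπ
  have hπs : Function.Surjective π := e.symm.surjective.comp Ideal.Quotient.mk_surjective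
  have hkerπ : ∀ φ ∈ RingHom.ker π, ∃ c : P, φ = c * formalNodeRelation k m ν := by
    intro φ hφ
    rw [RingHom.mem_ker, hπ, RingHom.comp_apply, RingEquiv.toRingHom_eq_coe, RingHom.coe_coe,
      map_eq_zero_iff _ e.symm.injective, Ideal.Quotient.eq_zero_iff_mem,
      Ideal.mem_span_singleton'] at hφ
    obtain ⟨c, hc⟩ := hφ
    exact ⟨c, hc.symm⟩
  have hν0 : ∃ i, ν i ≠ 0 := exists_ne_zero_of_ringEquiv e
  have hconst : MvPowerSeries.constantCoeff (formalNodeRelation k m ν) = 0 := by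
    rw [constantCoeff_formalNodeRelation, if_neg]
    push Not
    exact hν0
  -- linear terms of the elements of `ker π`
  have hlin : ∀ φ ∈ RingHom.ker π, ∀ j : Fin 2 ⊕ Fin m,
      MvPowerSeries.coeff (Finsupp.single j 1) (formalNodeRelation k m ν) = 0 →
        MvPowerSeries.coeff (Finsupp.single j 1) φ = 0 := by
    intro φ hφ j hj
    obtain ⟨c, rfl⟩ := hkerπ φ hφ
    rw [MvPowerSeries.coeff_single_one_mul, hj, hconst, mul_zero, mul_zero, add_zero]
  have hdimle : ringKrullDim R ≤ (m + 1 : ℕ) := by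
    rw [ringKrullDim_eq_of_ringEquiv e]
    exact ringKrullDim_le k m ν
  by_cases hsingle : ∃ i₀, ν = Pi.single i₀ 1
  · obtain ⟨i₀, hi₀⟩ := hsingle
    refine ⟨i₀, hi₀, le_antisymm hdimle ?_⟩
    -- the `m + 1` variables other than `T_{i₀}` are independent modulo `𝔪²`
    have h := MvPowerSeries.card_le_ringKrullDim_of_surjective π hπs
      (Finset.univ.erase (Sum.inr i₀)) (fun φ hφ j hj => hlin φ hφ j ?_)
    · rwa [Finset.card_erase_of_mem (Finset.mem_univ _), Finset.card_univ, Fintype.card_sum,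
        Fintype.card_fin, Fintype.card_fin, show 2 + m - 1 = m + 1 by omega] at h
    · rcases j with a | i
      · exact coeff_single_one_formalNodeRelation_inl k m ν a
      · refine coeff_single_one_formalNodeRelation_inr k m ν i ?_
        rw [hi₀]
        intro heq
        have hi : i = i₀ := by
          have := congrFun heq i
          simp only [Pi.single_apply] at this
          by_contra hne
          rw [if_neg hne] at this
          exact one_ne_zero this.symm
        subst hi
        exact (Finset.mem_erase.mp hj).1 rfl
  · -- all `m + 2` variables are independent modulo `𝔪²`: contradiction with `dim R ≤ m + 1`
    exfalso
    push Not at hsingle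
    have h := MvPowerSeries.card_le_ringKrullDim_of_surjective π hπs Finset.univ
      (fun φ hφ j _ => hlin φ hφ j ?_)
    · rw [Finset.card_univ, Fintype.card_sum, Fintype.card_fin, Fintype.card_fin] at h
      have h3 := h.trans hdimle
      have h4 : (2 + m : ℕ) ≤ m + 1 := by exact_mod_cast h3
      omega
    · rcases j with a | i
      · exact coeff_single_one_formalNodeRelation_inl k m ν a
      · exact coeff_single_one_formalNodeRelation_inr k m ν i (hsingle i)

end FormalNodeRing

end DeJong1996

/-! ## Formal coordinates on a complete regular local ring presented as a formal node ring -/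

/-- The parameters of the node: if `c_{i₀} ∈ (a)`, then `a, b, (cᵢ)_{i ≠ i₀}` (listed as
`Fin.cons a (Fin.cons b (c ∘ i₀.succAbove))`) generate the same ideal as `a, b, c₀, …, c_m`.
[folklore] -/
theorem Ideal.span_range_node_eq {R : Type*} [CommRing R] {m : ℕ} (a b : R) (c : Fin (m + 1) → R)
    (i₀ : Fin (m + 1)) (hci₀ : c i₀ ∈ Ideal.span {a}) :
    Ideal.span (Set.range (Fin.cons a (Fin.cons b (c ∘ i₀.succAbove)) : Fin (m + 2) → R)) =
      Ideal.span ({a, b} ∪ Set.range c) := by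
  have hrange : Set.range (Fin.cons a (Fin.cons b (c ∘ i₀.succAbove)) : Fin (m + 2) → R) =
      {a, b} ∪ Set.range (c ∘ i₀.succAbove) := by
    rw [Fin.range_cons, Fin.range_cons, Set.insert_union, Set.singleton_union]
  rw [hrange]
  apply le_antisymm
  · apply Ideal.span_mono
    rintro x (hx | ⟨j, rfl⟩)
    · exact Or.inl hx
    · exact Or.inr ⟨i₀.succAbove j, rfl⟩
  · rw [Ideal.span_le]
    rintro x (hx | ⟨i, rfl⟩)
    · exact Ideal.subset_span (Or.inl hx)
    · by_cases hi : i = i₀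
      · subst hi
        have ha : a ∈ Ideal.span ({a, b} ∪ Set.range (c ∘ i.succAbove)) :=
          Ideal.subset_span (Or.inl (Set.mem_insert a {b}))
        obtain ⟨r, hr⟩ := Ideal.mem_span_singleton'.mp hci₀
        rw [SetLike.mem_coe, ← hr]
        exact Ideal.mul_mem_left _ r ha
      · obtain ⟨j, rfl⟩ := Fin.exists_succAbove_eq hi
        exact Ideal.subset_span (Or.inr ⟨j, rfl⟩)

/-- **Cohen coordinates adapted to the node.** Let `R` be a regular local ring containing a
field `k₀`, with residue field `ι : R/𝔪 ≅ K`, whose maximal ideal is generated by `a, b` and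
`c₀, …, c_m` (indices in `Fin (m + 1)`) with `c_{i₀} ∈ (a)` redundant, and `dim R = m + 2`. Then
there is an isomorphism of the completion `R̂` with `K⟦X₀, …, X_{m+1}⟧` sending `a ↦ X₀`,
`b ↦ X₁` and `c_{i₀.succAbove j} ↦ X_{j+2}` (the `cᵢ`, `i ≠ i₀`, in order): `a, b, (cᵢ)_{i ≠ i₀}`
is a regular system of parameters, to which `exists_ringEquiv_adicCompletion_mvPowerSeries_of_rsop`
applies. [cite: Matsumura1987, Thm. 29.7] -/
theorem exists_ringEquiv_adicCompletion_of_node (R : Type u) [CommRing R] [IsRegularLocalRing R]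
    (k₀ : Subring R) (hk₀ : IsField k₀) {K : Type u} [Field K] (ι : ResidueField R ≃+* K)
    {m : ℕ} (a b : R) (c : Fin (m + 1) → R) (i₀ : Fin (m + 1))
    (hgen : Ideal.span ({a, b} ∪ Set.range c) = maximalIdeal R) (hci₀ : c i₀ ∈ Ideal.span {a})
    (hdim : ringKrullDim R = (m + 2 : ℕ)) :
    ∃ e : AdicCompletion (maximalIdeal R) R ≃+* MvPowerSeries (Fin (m + 2)) K,
      ∀ j, e (algebraMap R _ ((Fin.cons a (Fin.cons b (c ∘ i₀.succAbove)) : Fin (m + 2) → R) j)) =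
        MvPowerSeries.X j := by
  have hw : Ideal.span (Set.range (Fin.cons a (Fin.cons b (c ∘ i₀.succAbove)) : Fin (m + 2) → R)) =
      maximalIdeal R := by
    rw [Ideal.span_range_node_eq a b c i₀ hci₀, hgen]
  exact exists_ringEquiv_adicCompletion_mvPowerSeries_of_rsop R k₀ hk₀ ι _ hw hdim

/-! ## B2 at the regular points of `Sing(f)`, from the split nodal structure -/

namespace DeJong1996.SemiStablePair

variable {k : Type u} [Field k] {X Y : Scheme.{u}} {f : X ⟶ Y} {g : Y ⟶ Spec (.of k)}
  {D : Set Y} {n : ℕ} {τ : Fin n → (Y ⟶ X)}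

/-- In Situation 4.23, a regular system of parameters of `𝒪_{Y,y}` adapted to `D`, indexed by a
single `Fin m`: `t : Fin m → 𝒪_{Y,y}` generating `𝔪_y`, `m = dim 𝒪_{Y,y}`, with
`I(D)_y = (∏_{i<ρ} tᵢ)`, `ρ ≤ m`, and `1 ≤ ρ` if `y ∈ D` (`exists_rsop_stalkIdeal_base`
re-indexed along `Fin.append`). [cite: DeJong1996, 2.4, p. 55] -/
theorem exists_rsop_stalkIdeal_base' (hS : SemiStablePair f g D τ) (y : Y) :
    ∃ (m ρ : ℕ) (t : Fin m → Y.presheaf.stalk y), ρ ≤ m ∧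
      ringKrullDim (Y.presheaf.stalk y) = m ∧
      Ideal.span (Set.range t) = maximalIdeal (Y.presheaf.stalk y) ∧
      stalkIdeal (vanishingIdeal ⟨D, hS.isStrictNormalCrossingsDivisor.isClosed⟩) y =
        Ideal.span {∏ i ∈ Finset.univ.filter (fun i : Fin m => i.val < ρ), t i} ∧
      (y ∈ D → 1 ≤ ρ) := by
  obtain ⟨ρ, e, t, s, hdim, hspan, hI, hρ⟩ := hS.exists_rsop_stalkIdeal_base y
  refine ⟨ρ + e, ρ, Fin.append t s, Nat.le_add_right ρ e, hdim, ?_, ?_, hρ⟩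
  · rw [range_fin_append, hspan]
  · rw [hI, Fin.prod_filter_lt_append]

/-- Reindexing the branches through the node: for `i₀ < ρ + 1`,
`∏_{i < ρ+1, i ≠ i₀} cᵢ = ∏_{j < ρ} c_{i₀.succAbove j}`. [folklore] -/
theorem prod_filter_erase_eq_prod_succAbove {M : Type*} [CommMonoid M] {m : ℕ}
    (c : Fin (m + 1) → M) (i₀ : Fin (m + 1)) (ρ : ℕ) (hi₀ : i₀.val < ρ + 1) :
    ∏ i ∈ (Finset.univ.filter (fun i : Fin (m + 1) => i.val < ρ + 1)).erase i₀, c i =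
      ∏ j ∈ Finset.univ.filter (fun j : Fin m => j.val < ρ), c (i₀.succAbove j) := by
  classical
  have hval : ∀ j : Fin m, (i₀.succAbove j).val < ρ + 1 ↔ j.val < ρ := fun j => by
    by_cases h : Fin.castSucc j < i₀
    · rw [Fin.succAbove_of_castSucc_lt _ _ h, Fin.val_castSucc]
      have h' : j.val < i₀.val := h
      omega
    · rw [Fin.succAbove_of_le_castSucc _ _ (not_lt.mp h), Fin.val_succ]
      omega
  have hset : (Finset.univ.filter (fun i : Fin (m + 1) => i.val < ρ + 1)).erase i₀ =
      (Finset.univ.filter (fun j : Fin m => j.val < ρ)).image i₀.succAbove := by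
    ext i
    simp only [Finset.mem_erase, Finset.mem_filter, Finset.mem_univ, true_and, Finset.mem_image]
    constructor
    · rintro ⟨hne, hlt⟩
      obtain ⟨j, rfl⟩ := Fin.exists_succAbove_eq hne
      exact ⟨j, (hval j).mp hlt, rfl⟩
    · rintro ⟨j, hj, rfl⟩
      exact ⟨Fin.succAbove_ne i₀ j, (hval j).mpr hj⟩
  rw [hset, Finset.prod_image (fun j _ j' _ h => Fin.succAbove_right_injective h)]

/-- **de Jong 1996, 4.25 (i) at the regular closed points of `Sing(f)` — PROVED from the split
nodal structure 3.3.** For a pair in Situation 4.23 over an algebraically closed field `k` with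
`dim X = d`, and a closed point `x ∈ Z` with `𝒪_{X,x}` regular at which `f` is not smooth, there
are `1 ≤ r ≤ d` and `𝒪̂_{X,x} ≅ k⟦X₁, …, X_d⟧` carrying the completed ideal of `Z` to `(X₁ ⋯ X_r)`.
See the module docstring for the proof ("if `Σ nᵢ = 1`, then the point `x` is regular on `X`":
`𝒪̂_{X,x} ≅ k⟦u, v, T⟧/(uv - T_{i₀}) = k⟦u, v, (Tᵢ)_{i ≠ i₀}⟧`, `Î_Z = (uv ∏_{i<ρ, i≠i₀} Tᵢ)`).
[cite: DeJong1996, 3.3 and 4.24, pp. 63, 75] -/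
theorem exists_ringEquiv_completedStalkIdeal_of_not_smooth [IsAlgClosed k]
    (hN : DeJong1996SplitNodalStructure.{u}) (hS : SemiStablePair f g D τ) {d : ℕ}
    (hd : topologicalKrullDim X = d) {x : X} (hx : IsClosed ({x} : Set X))
    (hreg : IsRegularLocalRing (X.presheaf.stalk x)) (hxZ : x ∈ semiStableBoundary f D τ)
    (hns : ∀ U : X.Opens, x ∈ U → ¬ Smooth (U.ι ≫ f)) :
    ∃ r : ℕ, 1 ≤ r ∧ r ≤ d ∧
      ∃ e : AdicCompletion (maximalIdeal (X.presheaf.stalk x)) (X.presheaf.stalk x) ≃+*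
          MvPowerSeries (Fin d) k,
        ∀ (U : X.affineOpens) (hU : x ∈ (U : X.Opens)),
          (completedStalkIdeal (vanishingIdeal ⟨semiStableBoundary f D τ,
              hS.isClosed_semiStableBoundary⟩) x U hU).map e.toRingHom =
            Ideal.span {normalCrossingsEquation k d r} := by
  classical
  haveI := hS.isIntegral
  haveI := hS.locallyOfFiniteType
  haveI := hreg
  -- notation: `B = 𝒪_{X,x}`, `φ = f_x^#`, `B̂`
  set B := X.presheaf.stalk x with hB
  set φ := (f.stalkMap x).hom with hφ
  set Bh := AdicCompletion (maximalIdeal B) B with hBh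
  haveI : IsRegularLocalRing Bh := isRegularLocalRing_adicCompletion B
  haveI : IsDomain Bh := isDomain_of_isRegularLocalRing _
  have hdimB : ringKrullDim B = d := by
    rw [hB, ringKrullDim_stalk_eq_of_isClosed (f ≫ g) hx, hd]
  have hdimBh : ringKrullDim Bh = d := by
    show ringKrullDim (AdicCompletion (maximalIdeal B) B) = d
    rw [ringKrullDim_adicCompletion, hdimB]
  -- the base parameters and the split nodal structure
  have hxD : f x ∈ D := hS.apply_mem_of_not_smooth hns hxZ
  obtain ⟨m, ρ, t, hρm, hdimA, hspanA, hIA, hρ⟩ := hS.exists_rsop_stalkIdeal_base' (f x)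
  obtain ⟨ρ, rfl⟩ : ∃ ρ', ρ = ρ' + 1 := ⟨ρ - 1, by have := hρ hxD; omega⟩
  obtain ⟨ν, e, hν, he⟩ := hN k X Y f g D n τ hS x hx hns m (ρ + 1) t hspanA hdimA hρm hIA
  -- regularity: `ν = δ_{i₀}`, `d = m + 1`
  obtain ⟨i₀, hνi₀, hdim'⟩ := FormalNodeRing.exists_eq_single_of_isRegularLocalRing e
  have hi₀ρ : i₀.val < ρ + 1 := by
    by_contra h
    have := hν i₀ (not_lt.mp h)
    rw [hνi₀, Pi.single_eq_same] at this
    exact one_ne_zero this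
  obtain ⟨m, rfl⟩ : ∃ m', m = m' + 1 := ⟨m - 1, by have := i₀.isLt; omega⟩
  obtain rfl : d = m + 2 := by
    rw [hdimBh] at hdim'
    exact_mod_cast hdim'
  -- the generators `a = u`, `b = v`, `cᵢ = Tᵢ` of `𝔪_{B̂}` pulled back along `e`
  set mk := Ideal.Quotient.mk (Ideal.span {formalNodeRelation k (m + 1) ν}) with hmk
  set a : Bh := e.symm (mk (MvPowerSeries.X (Sum.inl 0))) with ha
  set b : Bh := e.symm (mk (MvPowerSeries.X (Sum.inl 1))) with hb
  set c : Fin (m + 1) → Bh := fun i => e.symm (mk (MvPowerSeries.X (Sum.inr i))) with hc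
  have hct : ∀ i, c i = algebraMap B Bh (φ (t i)) := fun i => by
    rw [hc]
    dsimp only
    rw [← he i, RingEquiv.symm_apply_apply]
  have hν0 : ∃ i, ν i ≠ 0 := ⟨i₀, by rw [hνi₀, Pi.single_eq_same]; exact one_ne_zero⟩
  haveI := FormalNodeRing.isLocalRing k (m + 1) hν0
  have hgen : Ideal.span ({a, b} ∪ Set.range c) = maximalIdeal Bh := by
    have h1 : maximalIdeal Bh = (maximalIdeal (FormalNodeRing k (m + 1) ν)).map e.symm :=
      (map_ringEquiv_maximalIdeal e.symm).symm
    rw [h1, FormalNodeRing.maximalIdeal_eq_span k (m + 1) hν0, Ideal.map_span, ← Set.range_comp]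
    congr 1
    ext y
    simp only [Set.mem_union, Set.mem_insert_iff, Set.mem_singleton_iff, Set.mem_range,
      Function.comp_apply]
    constructor
    · rintro ((rfl | rfl) | ⟨i, rfl⟩)
      · exact ⟨Sum.inl 0, rfl⟩
      · exact ⟨Sum.inl 1, rfl⟩
      · exact ⟨Sum.inr i, rfl⟩
    · rintro ⟨j, rfl⟩
      rcases j with j | i
      · fin_cases j
        · exact Or.inl (Or.inl rfl)
        · exact Or.inl (Or.inr rfl)
      · exact Or.inr ⟨i, rfl⟩
  -- the relation: `c_{i₀} = a b`
  have hrel : c i₀ = a * b := by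
    have h1 : mk (MvPowerSeries.X (Sum.inr i₀)) =
        mk (MvPowerSeries.X (Sum.inl 0)) * mk (MvPowerSeries.X (Sum.inl 1)) := by
      rw [hmk, FormalNodeRing.mk_X_mul_X, hνi₀]
      congr 1
      rw [Finset.prod_eq_single i₀ (fun i _ hi => by rw [Pi.single_apply, if_neg hi, pow_zero])
        (fun h => (h (Finset.mem_univ _)).elim), Pi.single_eq_same, pow_one]
    rw [ha, hb, ← map_mul, ← h1]
  have hci₀ : c i₀ ∈ Ideal.span {a} := by
    rw [hrel]
    exact Ideal.mul_mem_right b _ (Ideal.mem_span_singleton_self a)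
  -- the field `k ⊆ B̂` and the residue field `κ = k`
  let ψ : k →+* Bh := (algebraMap B Bh).comp ((X.presheaf.germ ⊤ x trivial).hom.comp
    ((f ≫ g).appTop.hom.comp (Scheme.ΓSpecIso (.of k)).inv.hom))
  have hψ : Function.Injective ψ := ψ.injective
  let k₀ : Subring Bh := ψ.range
  have hk₀ : IsField k₀ :=
    MulEquiv.isField (Field.toIsField k) (RingEquiv.ofBijective ψ.rangeRestrict
      ⟨fun a b h => hψ (congrArg Subtype.val h), ψ.rangeRestrict_surjective⟩).symm.toMulEquiv
  let ι : ResidueField Bh ≃+* k :=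
    (RingEquiv.ofBijective _ (AdicCompletion.residueField_map_bijective B)).symm.trans
      (residueFieldIsoBase (f ≫ g) x hx).commRingCatIsoToRingEquiv
  -- Cohen coordinates on the complete `B̂`: `E : B̂ ≅ (B̂)^ ≅ k⟦X₀, …, X_{m+1}⟧`, `w ↦ X`
  set w : Fin (m + 2) → Bh := Fin.cons a (Fin.cons b (c ∘ i₀.succAbove)) with hw
  obtain ⟨E₀, hE₀⟩ := exists_ringEquiv_adicCompletion_of_node Bh k₀ hk₀ ι a b c i₀ hgen hci₀
    hdimBh
  let E : Bh ≃+* MvPowerSeries (Fin (m + 2)) k :=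
    (AdicCompletion.ofAlgEquiv (maximalIdeal Bh)).toRingEquiv.trans E₀
  have hEw : ∀ j, E (w j) = MvPowerSeries.X j := fun j => by
    rw [← hE₀ j]
    rfl
  -- `w` is a regular system of parameters of `B̂`: pairwise non-associated primes
  have hwspan : Ideal.span (Set.range w) = maximalIdeal Bh := by
    rw [hw, Ideal.span_range_node_eq a b c i₀ hci₀, hgen]
  have hdimBh' : ringKrullDim Bh = ((m + 2 : ℕ) : ℕ) := hdimBh
  have hwp : ∀ j, Prime (w j) := fun j => prime_of_rsop w hwspan hdimBh' j
  have hwn : ∀ j j', j ≠ j' → ¬ w j ∣ w j' := fun j j' h => not_dvd_of_rsop w hwspan hdimBh' h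
  -- the product `∏_{i<ρ+1} f^#(tᵢ)` becomes `∏_{j<ρ+2} w_j` in `B̂`
  set α : B := ∏ i ∈ Finset.univ.filter (fun i : Fin (m + 1) => i.val < ρ + 1), φ (t i) with hα
  have hαw : algebraMap B Bh α =
      ∏ j ∈ Finset.univ.filter (fun j : Fin (m + 2) => j.val < ρ + 1 + 1), w j := by
    rw [hw, Fin.prod_filter_lt_cons, Fin.prod_filter_lt_cons, hα, map_prod]
    simp_rw [← hct]
    rw [← Finset.mul_prod_erase _ _ (Finset.mem_filter.mpr ⟨Finset.mem_univ i₀, hi₀ρ⟩), hrel,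
      mul_assoc, prod_filter_erase_eq_prod_succAbove c i₀ ρ hi₀ρ]
    rfl
  -- `(α)` is radical in `B`: its extension to the faithfully flat `B̂` is radical
  have hradBh : (Ideal.span {∏ j ∈ Finset.univ.filter (fun j : Fin (m + 2) => j.val < ρ + 1 + 1),
      w j}).radical = Ideal.span {∏ j ∈ Finset.univ.filter
        (fun j : Fin (m + 2) => j.val < ρ + 1 + 1), w j} :=
    Ideal.radical_span_singleton_prod_eq w _ (fun j _ => hwp j) (fun j _ j' _ h => hwn j j' h)
  haveI : Module.FaithfullyFlat B Bh := Module.FaithfullyFlat.of_flat_of_isLocalHom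
  have hradα : (Ideal.span {α}).radical = Ideal.span {α} := by
    refine le_antisymm (fun z hz => ?_) Ideal.le_radical
    rw [← Ideal.comap_map_eq_self_of_faithfullyFlat (B := Bh) (Ideal.span {α}), Ideal.mem_comap,
      Ideal.map_span, Set.image_singleton, hαw, ← hradBh]
    obtain ⟨N, hN⟩ := (Ideal.mem_radical_iff.mp hz)
    refine Ideal.mem_radical_iff.mpr ⟨N, ?_⟩
    have h := Ideal.mem_map_of_mem (algebraMap B Bh) hN
    rwa [map_pow, Ideal.map_span, Set.image_singleton, hαw] at h
  -- the stalk of the ideal of `Z` at `x` is `(α)`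
  have hIZ : stalkIdeal (vanishingIdeal ⟨semiStableBoundary f D τ,
      hS.isClosed_semiStableBoundary⟩) x = Ideal.span {α} := by
    rw [hS.stalkIdeal_semiStableBoundary_of_not_smooth hns, hIA, Ideal.map_span,
      Set.image_singleton, map_prod, ← hφ, ← hα, hradα]
  -- conclusion, `r = ρ + 2`
  refine ⟨ρ + 1 + 1, by omega, by omega, E, fun U hU => ?_⟩
  rw [completedStalkIdeal_eq_map_stalkIdeal, hIZ, Ideal.map_span, Set.image_singleton, hαw,
    Ideal.map_span, Set.image_singleton]
  refine congrArg (fun y => Ideal.span {y}) ?_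
  rw [RingEquiv.toRingHom_eq_coe, RingHom.coe_coe, map_prod, normalCrossingsEquation]
  exact Finset.prod_congr rfl fun j _ => hEw j

end DeJong1996.SemiStablePair

/-! ## The assembly -/

/-- **B2β from the split nodal structure**: `DeJong1996SemiStableBoundaryNormalCrossingsSingF`
(3.3 with `Σ nᵢ = 1`) follows from `DeJong1996SplitNodalStructure` (2.23 + 3.3).
[cite: DeJong1996, 3.3, p. 63] -/
theorem DeJong1996SemiStableBoundaryNormalCrossingsSingF.of_splitNodalStructure
    (hN : DeJong1996SplitNodalStructure.{u}) :
    DeJong1996SemiStableBoundaryNormalCrossingsSingF.{u} :=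
  fun _k _ _ _X _Y _f _g _D _n _τ _d hS hd _x hx hreg hxZ hns =>
    hS.exists_ringEquiv_completedStalkIdeal_of_not_smooth hN hd hx hreg hxZ hns

/-- **B2 from the split nodal structure**: the formal normal crossings of the boundary at all
nonsingular closed points (`DeJong1996SemiStableBoundaryNormalCrossings`, 4.24: "`Z` is already
everywhere a divisor with normal crossings, except in the singular points of `X`").
[cite: DeJong1996, 4.24, p. 75] -/
theorem DeJong1996SemiStableBoundaryNormalCrossings.of_splitNodalStructure
    (hN : DeJong1996SplitNodalStructure.{u}) :
    DeJong1996SemiStableBoundaryNormalCrossings.{u} :=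
  DeJong1996SemiStableBoundaryNormalCrossings.of_singF
    (DeJong1996SemiStableBoundaryNormalCrossingsSingF.of_splitNodalStructure hN)

/-- The target of the owning unit, 4.24 in sufficiency form (`DeJong1996SemiStablePairNormalForm`),
from the remaining leaves: Lemma 3.2 as printed, the split nodal structure 2.23/3.3, and the two
facts of 3.5 (nodal form at the singular points, regularity of the singular components).
[cite: DeJong1996, 4.24, p. 75] -/
theorem DeJong1996SemiStablePairNormalForm.of_lemma32_of_splitNodal_of_nodal_of_components
    (hA : DeJong1996Lemma32.{u}) (hN : DeJong1996SplitNodalStructure.{u})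
    (h₃ : DeJong1996CodimThreeNodalForm.{u})
    (h₅ : DeJong1996CodimThreeSingularComponentsRegular.{u}) :
    DeJong1996SemiStablePairNormalForm.{u} :=
  DeJong1996SemiStablePairNormalForm.of_lemma32_of_singF_of_nodal_of_components hA
    (DeJong1996SemiStableBoundaryNormalCrossingsSingF.of_splitNodalStructure hN) h₃ h₅

end Literature.AlgebraicGeometry.Resolution

end
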